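import Summits.QuantumFields.BalabanUV.Beta.RelInvNullShift
import Summits.QuantumFields.BalabanUV.Beta.SymShiftedSpread
import Summits.QuantumFields.BalabanUV.Beta.WardLocusInduction
import Summits.QuantumFields.BalabanUV.Beta.SymSliceProjectorDiagComm
import Summits.QuantumFields.BalabanUV.Beta.KernelWardHColumnSym
import Summits.QuantumFields.BalabanUV.Beta.KernelWardLevels

/-!
# `BalabanUV.Beta.WardLocusSymShift` — binder row D1, RULING R-D1-g28-1: THE (Sd) LETTER OF THE (0.4) LITERAL AT EVERY LEVEL, FROM ONE BORDER LETTER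
# (the block stencil Ward law of `SsymOf tabs` ∕ `(JsB12Sym0 …).S` against the shifted straight spread `bhKStepSh Dsh j`, generator
# `diagK (½ • Σ_{v∈box} legInd ρ_c (Lc•y+v))`, from (V-d) + (Dspr) + (Dnull) — level 0 by the Wilson divergence law and the pins, all levels by
# `WardLocusInductionBorder.hSd_all_border` at `(K, M, E, Vb) := (Gsym, bhKStepSh Dsh, symEc Lc, tabs.V)`)

HONEST FRAMING (cell charter, verbatim): «discharging BetaPertH makes Balaban's UV stability UNCONDITIONAL — a real constructive-QFT result; it is
NOT the continuum limit and NOT the Clay problem.»  HONEST DEPENDENCY: continuum YM on T⁴ ⇐ BetaPertH ∧ nine spine estimates (0/9 proved);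
BetaPertH ⇐ (D1) ∧ (D4) ∧ CAP+tail; G-an2-4 gates asym, D1 and NE2/3/4.
DERIVED cell leaf (β sub-cell, BINDER-OWNERS row D1 OWNER `b2b-balaban-beta-an2`, gen 28; brick (N1) of memo `gen27/JSB12SYM-SPINE.v1.4.md` §7.9 under
RULING R-D1-g28-1).  WHAT IT DOES: of the five root-level hypothesis classes of the row's END at the literal
(`RowD1JointEndSym.d1Drift_JsB12Sym_of_letters_D1Tel_D1Rep`), the hW class carries the Ward divergence letter (Sd) of the first-order tables
`(JsB12Sym0 hLc N tabs cΛ cB j).S` at EVERY level `j`.  This file proves (Sd) — against the shifted straight spread of R-D1-g28-1 and with the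
generator PINNED to `diagK (½ • Σ_v legInd ρ_c (Lc•y+v))` — from THREE letters about ONE displayed datum `Dsh` and the border table `tabs.V`:
(Dspr) `Spr Dsh`, (Dnull) `symEc ∘ Dsh ∘ symEc = 0`, (V-d) the pointwise border law `conjV (bhK + Dsh) (diagK (legInd ρ_c u)) =
conjV (ffK bhK) (diagK (legInd ρ_c u)) − Lc^{d+1} • divV tabs.V u` (an1-g36's X-an2-55 line (α), the shape of `conjV_bhKAt_diagK_legInd`).
Everything else is IN TREE BY NAME: `decays_Gsym`, `spr_bhKStepSh`, `spr_symEc`, `RelInvNullShift.relInv_Gsym_bhKStep_add` (K3-b transferred),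
`locStencil_SrecOf`, `KernelWardHColumnSym.colH_ward_coDressKSymAt_KInvStep` (hH), `KernelWardLevels.loc_diagK_smul_sum_legInd` (hX),
`SymSliceProjectorDiagComm.comp_symEc_blockGen_comm` (hEX), `RecursiveStencilSlot.divV_SrecOf_succ` (hT), `SymShiftedSpread.conjV_bhKStepSh_succ_…` (hM′),
`WilsonDivergenceContact.divV_wilsonA_eq_conjV` (level 0), `WardLocusInduction.stepLocks_bcj_iff` (the pins `(cE, cVH) = (Lc^{d+1}, −Lc^{2(d+1)}∕2)` close
the locks with ξ ≡ ½).  HONEST: (Sd) REDUCED to (V-d)+(Dspr)+(Dnull) — letters about an1's table VALUES and the symmetrised border, NOT proved here;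
root-level classes still 0∕5 discharged (the hW class now reads «(V-d)+(Dspr)+(Dnull)+(Wd)»); tables 0∕5; NOT D1, NOT `BetaPertH`, NOT continuum, NOT Clay.
No statement of Bałaban's papers, no `[cite:]`, no `Prop` fact, no `def`.
WHAT ([folklore]): §1 `ffK_bhKAt_eq_ffK_bhK`, `divV_S0NOf` (Λ-null, slot-generic), **`hSd_S0NOf_of_borderLaw`** (level 0); §2 **`hSd_SrecOf_Gsym_bhKStepSh_all`**
(all levels, generic `d`, pins as lock hypotheses); §3 **`hSd_SsymOf_all`**, **`hSd_JsB12Sym0`** (d + 1 = 4, the literal's pins, ξ ≡ ½, no lock hypothesis left).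
Provenance: β sub-cell, unit beta-an2 gen 28, 2026-08-21 (v1); over the files named above BY NAME; no existing file touched.
-/

noncomputable section

open Finset
open scoped BigOperators
open Literature.MathematicalPhysics.QuantumFieldTheory
open Literature.MathematicalPhysics.QuantumFieldTheory.Balaban1983to89
open Literature.MathematicalPhysics.QuantumFieldTheory.Balaban1983to89.Beta
open ExpKernelCalculus (MKer Decays comp VertexFamily)
open OneStepResolventKernel (Fib KInv LocStencil)
open OneStepKernelFamily (KInvStep)
open KernelWard (divV)
open AffineAveraging (box toSite)
open AveragingContoursRooted (ctr ctrOff ctrOff_mem_box)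
open InterLevelTransport (SLam)
open BalabanStepJets (lamCoeffOf)
open StepJetData (wilsonA)
open BalabanStepJetsSucc (mmRead wE wVH E2)
open WilsonVertex2Sym (wsym22)
open Summit.QuantumFields.BalabanUV.Beta.TameKernelCalculus
open Summit.QuantumFields.BalabanUV.Beta.ChartConjugation (conjV)
open Summit.QuantumFields.BalabanUV.Beta.AxialDressingRooted (one_le_of_neZero)
open Summit.QuantumFields.BalabanUV.Beta.BorderedHessian (bhK bhKAt bhKAt_inl_inl stepScale stepScale_ne_zero diagK conjV_diagK_apply)
open Summit.QuantumFields.BalabanUV.Beta.AveragingWardRootedStencils (legInd)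
open Summit.QuantumFields.BalabanUV.Beta.WardLocusStencils (ffK ffK_inl_inl ffK_inl_inr ffK_inr_inl ffK_inr_inr divV_apply divV_SLam_lamCoeffOf_eq_zero)
open Summit.QuantumFields.BalabanUV.Beta.WardLocusS0N (conjV_diagK_smul conjV_diagK_sum)
open Summit.QuantumFields.BalabanUV.Beta.WardLocusCubic (e3K)
open Summit.QuantumFields.BalabanUV.Beta.WardLocusRecursive (SrecOf SrecOf_zero)
open Summit.QuantumFields.BalabanUV.Beta.SpineRooted (S0NOf locStencil_SrecOf divV_SrecOf_succ)
open Summit.QuantumFields.BalabanUV.Beta.WardLocusInduction (wVH_eq_stepScale_sq wE_eq_stepScale_cube stepLocks_bcj_iff)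
open Summit.QuantumFields.BalabanUV.Beta.WardLocusInductionBorder (hSd_all_border)
open Summit.QuantumFields.BalabanUV.Beta.WilsonDivergenceContact (divV_wilsonA_eq_conjV)
open Summit.QuantumFields.BalabanUV.Beta.SymSliceProjectorKernel (symEc)
open Summit.QuantumFields.BalabanUV.Beta.SymSliceProjectorSpread (spr_symEc)
open Summit.QuantumFields.BalabanUV.Beta.SymSliceProjectorDiagComm (comp_symEc_blockGen_comm)
open Summit.QuantumFields.BalabanUV.Beta.KernelWardHColumnSym (colH_ward_coDressKSymAt_KInvStep)
open Summit.QuantumFields.BalabanUV.Beta.KernelWardLevels (loc_diagK_smul_sum_legInd)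
open Summit.QuantumFields.BalabanUV.Beta.SymmetrisedStepJets (SymTables Gsym Gsym_apply decays_Gsym SsymOf SsymOf_eq JsSym0Of JsSym0Of_S JsB12Sym0 JsB12Sym0_eq)
open Summit.QuantumFields.BalabanUV.Beta.RelInvNullShift (relInv_Gsym_bhKStep_add)
open Summit.QuantumFields.BalabanUV.Beta.SymShiftedSpread (bhKStepSh bhKStepSh_apply bhKStepSh_zero spr_bhKStepSh conjV_bhKStepSh_succ_diagK_legInd_of_borderLaw)

namespace Summit.QuantumFields.BalabanUV.Beta.WardLocusSymShift

variable {d : ℕ}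

/-! ## §1 Level `0`: the slotted native spine against the shifted bordered Hessian `bhK + D`, from the Wilson law and (V-d) -/

section LevelZero

variable {Lc : ℕ} [NeZero Lc]

/-- [folklore] The field–field window of the rooted bordered Hessian is root-free: `ffK (bhKAt d ρ L) = ffK (bhK L)` (`bhKAt_inl_inl`). -/
theorem ffK_bhKAt_eq_ffK_bhK (ρ : Fin (d + 1) → ℤ) (L : ℕ) [NeZero L] : ffK (bhKAt d ρ L) = ffK (bhK (d := d) L) := by
  funext x z a b
  rcases a with κ | κ <;> rcases b with l | l
  · rw [ffK_inl_inl, ffK_inl_inl, bhKAt_inl_inl]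
  · rw [ffK_inl_inr, ffK_inl_inr]
  · rw [ffK_inr_inl, ffK_inr_inl]
  · rw [ffK_inr_inr, ffK_inr_inr]

/-- [folklore] **THE DIVERGENCE OF THE SLOTTED NATIVE SPINE HAS NO Λ-PART** (slot-generic twin of `WardLocusS0N.divV_S0NAt`; (LH) at the decay rate of
`KInv Lc`): `divV (S0NOf V H cE cVH cΛ) u = cE • divV wilsonA u + cVH • divV V u`. -/
theorem divV_S0NOf {V H : Fin (d + 1) → (Fin (d + 1) → ℤ) → MKer (d + 1) (Fib d)} (hH : ∀ δ : ℝ, 0 ≤ δ → ∃ C : ℝ, VertexFamily H Lc C δ)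
    (cE cVH cΛ : ℝ) (u : Fin (d + 1) → ℤ) :
    divV (S0NOf d Lc V H cE cVH cΛ) u = cE • divV (wilsonA d) u + cVH • divV V u := by
  obtain ⟨δ₀, C, hδ₀, hC, hdec⟩ := OneStepResolventKernel.decays_KInv (N := Lc) (d := d)
  obtain ⟨Cq, hQ⟩ := hH δ₀ hδ₀.le
  have hΛ := divV_SLam_lamCoeffOf_eq_zero (N := Lc) hdec hC hδ₀ hQ u
  funext x z a b
  have hΛ' := congr_fun (congr_fun (congr_fun (congr_fun hΛ x) z) a) b
  simp only [divV_apply, Pi.zero_apply, Finset.sum_sub_distrib] at hΛ'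
  simp only [divV_apply, Pi.add_apply, Pi.smul_apply, smul_eq_mul, S0NOf, Finset.sum_add_distrib, Finset.sum_sub_distrib, ← Finset.mul_sum]
  linear_combination cΛ * hΛ'

/-- [folklore] **(Sd) AT LEVEL `0` FROM THE BORDER LETTER (V-d)**: for any first-order tables `V`, `H` ((LH) at every rate), any shift `D` obeying the border
law (V-d) `conjV (bhK + D) (diagK (legInd ρ u)) = conjV (ffK bhK) (diagK (legInd ρ u)) − Lc^{d+1} • divV V u`, and constants on the level-`0` LOCK
`cH·cE/2 = ξ`, `cH·cVH = −ξ·Lc^{d+1}`:  `cH • Σ_{v∈box} divV (S0NOf V H cE cVH cΛ) (Lc•y+v) = conjV (bhK + D) (diagK (ξ • Σ_v legInd ρ (Lc•y+v)))`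
(Wilson sector by leaf-05's `divV_wilsonA_eq_conjV`, constant `½`, root-free window). -/
theorem hSd_S0NOf_of_borderLaw (ρ : Fin (d + 1) → ℤ) {V H : Fin (d + 1) → (Fin (d + 1) → ℤ) → MKer (d + 1) (Fib d)} {D : MKer (d + 1) (Fib d)}
    (hH : ∀ δ : ℝ, 0 ≤ δ → ∃ C : ℝ, VertexFamily H Lc C δ)
    (hVd : ∀ u : Fin (d + 1) → ℤ, conjV (bhK Lc + D) (diagK (legInd ρ u)) =
      conjV (ffK (bhK (d := d) Lc)) (diagK (legInd ρ u)) - ((Lc : ℝ) ^ (d + 1)) • divV V u)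
    {cE cVH cΛ cH ξ : ℝ} (h₁ : cH * cE * (1 / 2) = ξ) (h₂ : cH * cVH = -(ξ * (Lc : ℝ) ^ (d + 1))) (y : Fin (d + 1) → ℤ) :
    cH • ∑ v ∈ box (d + 1) Lc, divV (S0NOf d Lc V H cE cVH cΛ) ((Lc : ℤ) • y + toSite v) =
      conjV (bhK Lc + D) (diagK (ξ • ∑ v ∈ box (d + 1) Lc, legInd ρ ((Lc : ℤ) • y + toSite v))) := by
  have key : ∀ u : Fin (d + 1) → ℤ, cH • divV (S0NOf d Lc V H cE cVH cΛ) u = ξ • conjV (bhK Lc + D) (diagK (legInd ρ u)) := by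
    intro u
    have hW := divV_wilsonA_eq_conjV (d := d) ρ Lc u
    rw [ffK_bhKAt_eq_ffK_bhK] at hW
    rw [divV_S0NOf hH, hW, hVd u]
    funext x z a b
    simp only [Pi.smul_apply, Pi.add_apply, Pi.sub_apply, smul_eq_mul]
    linear_combination (conjV (ffK (bhK (d := d) Lc)) (diagK (legInd ρ u)) x z a b) * h₁ + (divV V u x z a b) * h₂
  rw [Finset.smul_sum, conjV_diagK_smul, conjV_diagK_sum, Finset.smul_sum]
  exact Finset.sum_congr rfl fun v _ => key _

end LevelZero

/-! ## §2 All levels: the slotted recursive family at the symmetrised resolvents against the shifted straight spread -/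

section All

variable {Lc : ℕ} [NeZero Lc]

/-- [folklore] **(Sd) AT EVERY LEVEL FOR `SrecOf V H Gsym` AGAINST `bhKStepSh D`** (generic `d`; the pins as lock hypotheses).  Letters: (LV) `V`
localised at every rate, (LH) `H` a vertex family at every rate, (Dspr) `Spr D`, (Dnull) `symEc ∘ D ∘ symEc = 0`, (V-d) the border law of `V`
against `bhK + D` with centre root; locks: level `0` `(stepScale 0·Lc^{d+1})⁻¹·cE/2 = ξ`, `(stepScale 0·Lc^{d+1})⁻¹·cVH = −ξ·Lc^{d+1}`, steps (h₁)(h₂) of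
`WardLocusInductionBorder.hSd_all_border` with `a = cE·wE`, `b = cVH·wVH`, `w = wVH`, `P = stepScale·Lc^{d+1}`, constant ξ.  Conclusion:
`∀ j y, (stepScale j·Lc^{d+1})⁻¹ • Σ_{v∈box} divV (SrecOf V H Gsym cE cVH cΛ j) (Lc•y+v) = conjV (bhKStepSh D j) (diagK (ξ • Σ_v legInd ρ_c (Lc•y+v)))`. -/
theorem hSd_SrecOf_Gsym_bhKStepSh_all {V H : Fin (d + 1) → (Fin (d + 1) → ℤ) → MKer (d + 1) (Fib d)} {D : MKer (d + 1) (Fib d)}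
    (hV : ∀ δ : ℝ, 0 ≤ δ → ∃ C : ℝ, LocStencil V C δ) (hH : ∀ δ : ℝ, 0 ≤ δ → ∃ C : ℝ, VertexFamily H Lc C δ)
    (hD : Spr D) (hDnull : comp (comp (symEc Lc) D) (symEc Lc) = 0)
    (hVd : ∀ u : Fin (d + 1) → ℤ, conjV (bhK Lc + D) (diagK (legInd (ctr (d + 1) Lc) u)) =
      conjV (ffK (bhK (d := d) Lc)) (diagK (legInd (ctr (d + 1) Lc) u)) - ((Lc : ℝ) ^ (d + 1)) • divV V u)
    {cE cVH cΛ ξ : ℝ}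
    (h0₁ : (stepScale d Lc 0 * (Lc : ℝ) ^ (d + 1))⁻¹ * cE * (1 / 2) = ξ)
    (h0₂ : (stepScale d Lc 0 * (Lc : ℝ) ^ (d + 1))⁻¹ * cVH = -(ξ * (Lc : ℝ) ^ (d + 1)))
    (h₁ : ∀ j, (stepScale d Lc (j + 1) * (Lc : ℝ) ^ (d + 1))⁻¹ * (cE * wE d Lc (j + 1)) * ξ = ξ * wVH d Lc (j + 1))
    (h₂ : ∀ j, (stepScale d Lc (j + 1) * (Lc : ℝ) ^ (d + 1))⁻¹ * (cVH * wVH d Lc (j + 1)) = -(ξ * (stepScale d Lc (j + 1) * (Lc : ℝ) ^ (d + 1)))) :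
    ∀ (j : ℕ) (y : Fin (d + 1) → ℤ),
      (stepScale d Lc j * (Lc : ℝ) ^ (d + 1))⁻¹ • ∑ v ∈ box (d + 1) Lc, divV (SrecOf d Lc V H (Gsym Lc) cE cVH cΛ j) ((Lc : ℤ) • y + toSite v) =
        conjV (bhKStepSh d Lc D j) (diagK (ξ • ∑ v ∈ box (d + 1) Lc, legInd (ctr (d + 1) Lc) ((Lc : ℤ) • y + toSite v))) := by
  have hLc : 1 ≤ Lc := one_le_of_neZero Lc
  have hr : ctrOff (d + 1) Lc ∈ box (d + 1) Lc := ctrOff_mem_box hLc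
  have hH1 : ∃ C δ : ℝ, 0 < δ ∧ VertexFamily H Lc C δ := by obtain ⟨C, hC⟩ := hH 1 zero_le_one; exact ⟨C, 1, one_pos, hC⟩
  choose Cs δs hδs hS using locStencil_SrecOf (d := d) hLc hV hH (decays_Gsym Lc) cE cVH cΛ
  exact hSd_all_border hLc hr (K := fun j => Gsym (d := d) Lc j) (M := fun j => bhKStepSh d Lc D j) (E := symEc Lc)
    (decays_Gsym Lc) (spr_bhKStepSh hD) (spr_symEc hLc) (fun j => relInv_Gsym_bhKStep_add (d := d) (Lc := Lc) j hD hDnull (stepScale d Lc j))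
    (S := fun j => SrecOf d Lc V H (Gsym Lc) cE cVH cΛ j) hS hδs (cH := fun j => (stepScale d Lc j * (Lc : ℝ) ^ (d + 1))⁻¹) (ξ := fun _ => ξ)
    (fun j y κ' u => colH_ward_coDressKSymAt_KInvStep (d := d) (Lc := Lc) j y κ' u) (fun j y => loc_diagK_smul_sum_legInd Lc _ ξ y)
    (fun j y => comp_symEc_blockGen_comm hLc _ ξ y) (Vb := V) (a := fun j => cE * wE d Lc j) (b := fun j => cVH * wVH d Lc j)
    (w := fun j => wVH d Lc j) (P := fun j => stepScale d Lc j * (Lc : ℝ) ^ (d + 1))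
    (fun j u => divV_SrecOf_succ hH1 cE cVH cΛ j u) (fun j u => conjV_bhKStepSh_succ_diagK_legInd_of_borderLaw hVd j u) h₁ h₂
    (fun y => by
      rw [bhKStepSh_zero]
      exact hSd_S0NOf_of_borderLaw (ctr (d + 1) Lc) hH hVd h0₁ h0₂ y)

/-- [folklore] **THE LOCKS AT THE PINS `(cE, cVH) = (Lc^{d+1}, −Lc^{d+1}·½·Lc^{d+1})` CLOSE WITH ξ ≡ ½** (`stepLocks_bcj_iff` with `cE′ = ½`; level `0`
by `stepScale 0 = 1`).  The all-levels law with NO lock hypothesis left. -/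
theorem hSd_SrecOf_Gsym_bhKStepSh_all_pins {V H : Fin (d + 1) → (Fin (d + 1) → ℤ) → MKer (d + 1) (Fib d)} {D : MKer (d + 1) (Fib d)}
    (hV : ∀ δ : ℝ, 0 ≤ δ → ∃ C : ℝ, LocStencil V C δ) (hH : ∀ δ : ℝ, 0 ≤ δ → ∃ C : ℝ, VertexFamily H Lc C δ)
    (hD : Spr D) (hDnull : comp (comp (symEc Lc) D) (symEc Lc) = 0)
    (hVd : ∀ u : Fin (d + 1) → ℤ, conjV (bhK Lc + D) (diagK (legInd (ctr (d + 1) Lc) u)) =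
      conjV (ffK (bhK (d := d) Lc)) (diagK (legInd (ctr (d + 1) Lc) u)) - ((Lc : ℝ) ^ (d + 1)) • divV V u)
    (cΛ : ℝ) :
    ∀ (j : ℕ) (y : Fin (d + 1) → ℤ),
      (stepScale d Lc j * (Lc : ℝ) ^ (d + 1))⁻¹ • ∑ v ∈ box (d + 1) Lc,
          divV (SrecOf d Lc V H (Gsym Lc) ((Lc : ℝ) ^ (d + 1)) (-((Lc : ℝ) ^ (d + 1) * (1 / 2) * (Lc : ℝ) ^ (d + 1))) cΛ j) ((Lc : ℤ) • y + toSite v) =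
        conjV (bhKStepSh d Lc D j) (diagK ((1 / 2 : ℝ) • ∑ v ∈ box (d + 1) Lc, legInd (ctr (d + 1) Lc) ((Lc : ℤ) • y + toSite v))) := by
  have hL : (Lc : ℝ) ^ (d + 1) ≠ 0 := pow_ne_zero _ (by exact_mod_cast NeZero.ne Lc)
  have hc : (Lc : ℝ) ^ (d + 1) * (1 / 2) ≠ 0 := mul_ne_zero hL (by norm_num)
  have hξ0 : (fun _ : ℕ => (1 / 2 : ℝ)) 0 = (Lc : ℝ) ^ (d + 1) * (1 / 2) / (Lc : ℝ) ^ (d + 1) := by field_simp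
  have hlocks := (stepLocks_bcj_iff (d := d) (Lc := Lc) hc (ξ := fun _ => (1 / 2 : ℝ)) hξ0 rfl).2 ⟨fun _ => rfl, rfl⟩
  refine hSd_SrecOf_Gsym_bhKStepSh_all hV hH hD hDnull hVd ?_ ?_ (fun j => (hlocks j).1) (fun j => (hlocks j).2)
  · rw [KernelWardLevels.stepScale_zero, one_mul]; field_simp
  · rw [KernelWardLevels.stepScale_zero, one_mul]; field_simp

end All

/-! ## §3 d + 1 = 4: the (Sd) letter of the literal `JsB12Sym0` at every level -/

section Literal

variable {Lc : ℕ} [NeZero Lc]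

/-- [folklore] **(Sd) FOR THE LITERAL'S FIRST-ORDER TABLES `SsymOf tabs`** (generic `d`, the pins of record): under (Dspr)(Dnull)(V-d),
`∀ j y, (stepScale j·Lc^{d+1})⁻¹ • Σ_{v∈box} divV (SsymOf tabs Lc^{d+1} (−Lc^{d+1}·½·Lc^{d+1}) cΛ j) (Lc•y+v) = conjV (bhKStepSh Dsh j) (diagK (½ • Σ_v legInd ρ_c (Lc•y+v)))`. -/
theorem hSd_SsymOf_all (tabs : SymTables d Lc) {Dsh : MKer (d + 1) (Fib d)} (hD : Spr Dsh) (hDnull : comp (comp (symEc Lc) Dsh) (symEc Lc) = 0)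
    (hVd : ∀ u : Fin (d + 1) → ℤ, conjV (bhK Lc + Dsh) (diagK (legInd (ctr (d + 1) Lc) u)) =
      conjV (ffK (bhK (d := d) Lc)) (diagK (legInd (ctr (d + 1) Lc) u)) - ((Lc : ℝ) ^ (d + 1)) • divV tabs.V u)
    (cΛ : ℝ) :
    ∀ (j : ℕ) (y : Fin (d + 1) → ℤ),
      (stepScale d Lc j * (Lc : ℝ) ^ (d + 1))⁻¹ • ∑ v ∈ box (d + 1) Lc,
          divV (SsymOf tabs ((Lc : ℝ) ^ (d + 1)) (-((Lc : ℝ) ^ (d + 1) * (1 / 2) * (Lc : ℝ) ^ (d + 1))) cΛ j) ((Lc : ℤ) • y + toSite v) =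
        conjV (bhKStepSh d Lc Dsh j) (diagK ((1 / 2 : ℝ) • ∑ v ∈ box (d + 1) Lc, legInd (ctr (d + 1) Lc) ((Lc : ℤ) • y + toSite v))) :=
  hSd_SrecOf_Gsym_bhKStepSh_all_pins tabs.hV tabs.hH hD hDnull hVd cΛ

/-- [folklore] **(Sd) FOR THE (0.4) LITERAL `JsB12Sym0 hLc N tabs cΛ cB` AT EVERY LEVEL** (d + 1 = 4; its pins `(cE, cVH) = (Lc⁴, −Lc⁸∕2)` ARE the
(Sd) pins): under (Dspr)(Dnull)(V-d),
`∀ j y, (stepScale 3 Lc j·Lc⁴)⁻¹ • Σ_{v∈box} divV (JsB12Sym0 … j).S (Lc•y+v) = conjV (bhKStepSh 3 Lc Dsh j) (diagK (½ • Σ_v legInd ρ_c (Lc•y+v)))` —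
the hypothesis `hSd` of the row's END at the literal, with spread `bhKStepSh 3 Lc Dsh j` and generator `Xʷ j y := diagK (½ • Σ_v legInd ρ_c (Lc•y+v))`. -/
theorem hSd_JsB12Sym0 (hLc : Odd Lc) (N : ℕ) (tabs : SymTables 3 Lc) (cΛ cB : ℝ) {Dsh : MKer 4 (Fib 3)} (hD : Spr Dsh)
    (hDnull : comp (comp (symEc Lc) Dsh) (symEc Lc) = 0)
    (hVd : ∀ u : Fin 4 → ℤ, conjV (bhK Lc + Dsh) (diagK (legInd (ctr 4 Lc) u)) =
      conjV (ffK (bhK (d := 3) Lc)) (diagK (legInd (ctr 4 Lc) u)) - ((Lc : ℝ) ^ 4) • divV tabs.V u) :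
    ∀ (j : ℕ) (y : Fin 4 → ℤ),
      (stepScale 3 Lc j * (Lc : ℝ) ^ (3 + 1))⁻¹ • ∑ v ∈ box 4 Lc, divV (JsB12Sym0 hLc N tabs cΛ cB j).S ((Lc : ℤ) • y + toSite v) =
        conjV (bhKStepSh 3 Lc Dsh j) (diagK ((1 / 2 : ℝ) • ∑ v ∈ box 4 Lc, legInd (ctr 4 Lc) ((Lc : ℤ) • y + toSite v))) := by
  intro j y
  have h := hSd_SsymOf_all (d := 3) tabs hD hDnull hVd cΛ j y
  have e : -((Lc : ℝ) ^ (3 + 1) * (1 / 2) * (Lc : ℝ) ^ (3 + 1)) = -((Lc : ℝ) ^ 8 / 2) := by ring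
  rw [e] at h
  rw [JsB12Sym0_eq, JsSym0Of_S]
  exact h

end Literal

end Summit.QuantumFields.BalabanUV.Beta.WardLocusSymShift

end
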